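import Summits.HodgeConjecture.HodgeConjecture.Theorems.F0P3cStCharTSOffStratumCM        -- ★ p849417 (this seat): `isLocalDeltaTransfer_of_on`
import Summits.HodgeConjecture.HodgeConjecture.Theorems.F0P3cStCharTSOnStratumH          -- ★ p849469 (this seat): `stableOrbitalIntegralRel_eq_classOrbitalIntegral_of_on`
import Summits.HodgeConjecture.HodgeConjecture.Theorems.F0P3cStCharTSOnStratumLeviFrame  -- filed p849532 (this seat): `exists_conj_fst_eq_glDiagonal_of_on`
import Literature.NumberTheory.Rogawski1990.UnitFundamentalLemmaInertLeviClause          -- ★ `isLocalGRegular_conj_iff`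
import HarnessLib

/-!
# F0 · P3c · line LH6 «StCharTS» — road (D) «DEEP-FL», brick D3-iv-c₂ «THE TRANSFER OF THE SHELL PAIR FOLLOWS FROM THE SCALAR IDENTITY ON THE DIAGONAL LEVI STRATUM»

Cell `pub/hodgecm-mathlib`, crux H413 = `stmt-HodgeConjecture-24833` (`--supports` lane, helper), route HCCMUnconditional; seat LH6-p04 (g2), road (D) owner;
status v3 `F0/P3b/LH6-p04/g2/ROAD-D.status.v3.txt` brick D3-iv (ON-stratum matching), part (c₂): the REDUCTION.  THEOREMS ONLY, sorry-free.  HONEST LABEL: HC_CM is proved only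
modulo the 7 printed citations (2 remaining: hLiu418 = stmt-HodgeConjecture-24832, h413 = stmt-HodgeConjecture-24833) until rung 0 closes; count-neutral.

WHAT.  §1 `hon_of_levi`: the ON-stratum identity `hon` of ★ `isLocalDeltaTransfer_of_on` (for ANY transfer factor `T`, measure families, `f^H`, `f`) follows from the
identity at DIAGONAL-LEVI representatives `γ_H = (glDiagonal 2 d′, u)`, `G`-regular, hyperbolic at `w` (`|d′₁|_w < |d′₀|_w`, `σ_w(d′₀,w) d′₁,w = 1`):
`Φ([γ_H], f^H) = Σ_c Δ(γ_H, c) Φ(c, f)` — by ★ D3-iv-c₁ (a Levi frame exists), ★ D3-iv-a (`Φ^st = Φ([γ_H])` on the stratum), ★ `isLocalGRegular_conj_iff`, the class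
invariance of `classOrbitalIntegral` and ★ `TransferFactorData.conj_left`.  §2 `isLocalDeltaTransfer_of_levi`: hence, for the shell pair of road (D) (`tsupport f ⊆ K_n (z aᵐ) K_n`,
`(tsupport f^H).1 ⊆ K₂ (z₂ a₂^m₂) K₂`), ★ `IsLocalDeltaTransfer L Φ₃ v T mH mG f^H f` follows from that Levi identity ALONE.  What remains of D3 («D3-iv-c proper») is thus a
scalar identity between the two closed-form shell orbital integrals on the hyperbolic torus (D3-ii) against ★ S3-B `Δ‴ = τ_v·D_{G∕H,v}` and ★ (L2)∕(L3).
[Rogawski1990, §4.3 (4.3.1) p. 43; §4.9 Lemma 4.9.2 p. 56; §3.6 p. 31.]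

## References
* [Rogawski1990] J. D. Rogawski, *Automorphic Representations of Unitary Groups in Three Variables*, Ann. of Math. Stud. 123 (1990), §3.6 p. 31; §4.3 p. 43; §4.9 p. 56.
* [PlatonovRapinchuk1994] V. Platonov, A. Rapinchuk, *Algebraic Groups and Number Theory* (1994), §5.1.
-/

set_option autoImplicit false
-- the mandated namespace has the single-problem summit's repeated segment (`HodgeConjecture.HodgeConjecture`)
set_option linter.dupNamespace false

noncomputable section

open Matrix Polynomial NumberField IsDedekindDomain
open scoped MatrixGroups
open Literature.NumberTheory.Rogawski1990 Literature.NumberTheory.Automorphic Literature.NumberTheory.Automorphic.UnitaryGroup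
open Literature.NumberTheory.GaloisRepresentations

namespace Summit.HodgeConjecture.HodgeConjecture.Cruxes.H413.F0P3cStCharTSTransferOfLevi

variable (L : Type) [Field L] [NumberField L] [IsCMField L] (v : HeightOneSpectrum (𝓞 ↥(maximalRealSubfield L)))
  (w : PlacesOver L v) (hw : IsCMField.complexConj L • w.1 = w.1)

/-! ## §1 `hon` from the identity at diagonal-Levi representatives -/

set_option maxHeartbeats 1600000 in  -- statement-level `whnf` on the CM carriers
/-- **D3-iv-c₂ «hon FROM THE LEVI IDENTITY».**  For any transfer factor `T` (e.g. Δ‴), orbital measure families `mH, mG` and functions `f^H, f`: if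
`Φ([γ_H], f^H) = Σ_c T.Δ γ_H (out c) · Φ(c, f)` holds at every `G`-regular DIAGONAL-LEVI `γ_H = (glDiagonal 2 d′, u)` hyperbolic at `w`, then the ON-stratum identity `hon` of
★ `isLocalDeltaTransfer_of_on` holds at every `G`-regular `γ_H` with `|det h₂|_w < |tr h₂|_w²`. [cite: Rogawski1990, §4.3 (4.3.1) p. 43; §3.6 p. 31] -/
theorem hon_of_levi
    [∀ γ : (cmDatum L 3 (qsForm L)).Local v, MeasurableSpace ((cmDatum L 3 (qsForm L)).Local v ⧸ Subgroup.centralizer ({γ} : Set ((cmDatum L 3 (qsForm L)).Local v)))]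
    [∀ aH : ((cmDatum L 2 (Matrix.of fun i j : Fin 2 => if i.val + j.val + 1 = 2 then (1 : L) else 0)).Local v × (cmDatum L 1 (Matrix.of fun i j : Fin 1 => if i.val + j.val + 1 = 1 then (1 : L) else 0)).Local v),
      MeasurableSpace (((cmDatum L 2 (Matrix.of fun i j : Fin 2 => if i.val + j.val + 1 = 2 then (1 : L) else 0)).Local v × (cmDatum L 1 (Matrix.of fun i j : Fin 1 => if i.val + j.val + 1 = 1 then (1 : L) else 0)).Local v) ⧸
        Subgroup.centralizer ({aH} : Set ((cmDatum L 2 (Matrix.of fun i j : Fin 2 => if i.val + j.val + 1 = 2 then (1 : L) else 0)).Local v × (cmDatum L 1 (Matrix.of fun i j : Fin 1 => if i.val + j.val + 1 = 1 then (1 : L) else 0)).Local v)))]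
    (T : LocalTransferFactor L (qsForm L) v)
    (mH : OrbitalMeasureFamily ((cmDatum L 2 (Matrix.of fun i j : Fin 2 => if i.val + j.val + 1 = 2 then (1 : L) else 0)).Local v ×
      (cmDatum L 1 (Matrix.of fun i j : Fin 1 => if i.val + j.val + 1 = 1 then (1 : L) else 0)).Local v))
    (mG : OrbitalMeasureFamily ((cmDatum L 3 (qsForm L)).Local v))
    (fH : ((cmDatum L 2 (Matrix.of fun i j : Fin 2 => if i.val + j.val + 1 = 2 then (1 : L) else 0)).Local v ×
      (cmDatum L 1 (Matrix.of fun i j : Fin 1 => if i.val + j.val + 1 = 1 then (1 : L) else 0)).Local v) → ℂ) (f : (cmDatum L 3 (qsForm L)).Local v → ℂ)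
    (hlevi : ∀ (γH : ((cmDatum L 2 (Matrix.of fun i j : Fin 2 => if i.val + j.val + 1 = 2 then (1 : L) else 0)).Local v × (cmDatum L 1 (Matrix.of fun i j : Fin 1 => if i.val + j.val + 1 = 1 then (1 : L) else 0)).Local v)) (d' : Fin 2 → (LocalRing L v)ˣ),
      glDiagonal 2 (LocalRing L v) d' = ((γH.1).val : GL (Fin 2) (LocalRing L v)) → IsLocalGRegular L v γH →
      Valued.v (((d' 1 : (LocalRing L v)ˣ) : LocalRing L v) w) < Valued.v (((d' 0 : (LocalRing L v)ˣ) : LocalRing L v) w) →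
      galAdicCompletionMap (L := L) (IsCMField.complexConj L) hw (((d' 0 : (LocalRing L v)ˣ) : LocalRing L v) w) * ((d' 1 : (LocalRing L v)ˣ) : LocalRing L v) w = 1 →
      classOrbitalIntegral mH fH (ConjClasses.mk γH) = ∑ᶠ c : ConjClasses ((cmDatum L 3 (qsForm L)).Local v), T.Δ γH (Quotient.out c) * classOrbitalIntegral mG f c)
    (γH : ((cmDatum L 2 (Matrix.of fun i j : Fin 2 => if i.val + j.val + 1 = 2 then (1 : L) else 0)).Local v × (cmDatum L 1 (Matrix.of fun i j : Fin 1 => if i.val + j.val + 1 = 1 then (1 : L) else 0)).Local v)) (hreg : IsLocalGRegular L v γH)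
    (hon : Valued.v ((Pi.evalRingHom (fun w' : PlacesOver L v => w'.1.adicCompletion L) w) ((γH.1.val : GL (Fin 2) (LocalRing L v)) : Matrix (Fin 2) (Fin 2) (LocalRing L v)).det) <
        Valued.v ((Pi.evalRingHom (fun w' : PlacesOver L v => w'.1.adicCompletion L) w) ((γH.1.val : GL (Fin 2) (LocalRing L v)) : Matrix (Fin 2) (Fin 2) (LocalRing L v)).trace) ^ 2) :
    stableOrbitalIntegralRel (IsLocalStablyConjH L v) mH fH γH = ∑ᶠ c : ConjClasses ((cmDatum L 3 (qsForm L)).Local v), T.Δ γH (Quotient.out c) * classOrbitalIntegral mG f c := by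
  obtain ⟨y, d', hyd', -, hlt, h01⟩ := F0P3cStCharTSOnStratumLeviFrame.exists_conj_fst_eq_glDiagonal_of_on L v w hw γH hon
  have hreg₁ : IsLocalGRegular L v (y * γH * y⁻¹) := (isLocalGRegular_conj_iff L y γH).2 hreg
  have hconj : IsConj γH (y * γH * y⁻¹) := isConj_iff.2 ⟨y, rfl⟩
  rw [F0P3cStCharTSOnStratumH.stableOrbitalIntegralRel_eq_classOrbitalIntegral_of_on L v w hw mH fH γH hon, ConjClasses.mk_eq_mk_iff_isConj.2 hconj,
    hlevi (y * γH * y⁻¹) d' hyd' hreg₁ hlt h01]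
  exact finsum_congr fun c => by rw [T.conj_left]

/-! ## §2 The transfer of the shell pair from the Levi identity -/

set_option maxHeartbeats 1600000 in  -- statement-level `whnf` on the CM carriers
/-- **D3 ⇐ THE LEVI IDENTITY.**  With the `G`-side and `H`-side shell data of ★ D3-iii (`K_n` of level `r < 1` under `E₃`, central `z`, ray `a`, `m ≥ 1`; `K₂`, `z₂`, `a₂`, `m₂`),
a transfer factor `T`, orbital measure families `mH, mG`, and a pair `(f^H, f)` with `tsupport f ⊆ K_n (z aᵐ) K_n`, `(tsupport f^H).1 ⊆ K₂ (z₂ a₂^m₂) K₂`: if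
`Φ([γ_H], f^H) = Σ_c T.Δ γ_H (out c) Φ(c, f)` at every `G`-regular diagonal-Levi `γ_H` hyperbolic at `w`, then `IsLocalDeltaTransfer L Φ₃ v T mH mG f^H f`.
[cite: Rogawski1990, §4.3 (4.3.1) p. 43; §4.9 p. 56; §12.7 L. 12.7.3 (proof) p. 195] -/
theorem isLocalDeltaTransfer_of_levi
    (Kn : Subgroup ((cmDatum L 3 (qsForm L)).Local v)) {r : WithZero (Multiplicative ℤ)} (hr : r < 1)
    (hK : ∀ k ∈ Kn, ∀ i j, Valued.v ((((localNonsplitEquiv (IsCMField.complexConj L) (qsForm L) (IsCMField.complexConj_ne_one L) w hw k :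
        ↥(unitaryGroupOfForm (galAdicCompletionMap (L := L) (IsCMField.complexConj L) hw) (placeForm (qsForm L) w.1))) :
        GL (Fin 3) (w.1.adicCompletion L)) : Matrix (Fin 3) (Fin 3) (w.1.adicCompletion L)) i j - (1 : Matrix (Fin 3) (Fin 3) (w.1.adicCompletion L)) i j) ≤ r)
    {z a : (cmDatum L 3 (qsForm L)).Local v} {β α : w.1.adicCompletion L}
    (hz : (((localNonsplitEquiv (IsCMField.complexConj L) (qsForm L) (IsCMField.complexConj_ne_one L) w hw z :
        ↥(unitaryGroupOfForm (galAdicCompletionMap (L := L) (IsCMField.complexConj L) hw) (placeForm (qsForm L) w.1))) :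
        GL (Fin 3) (w.1.adicCompletion L)) : Matrix (Fin 3) (Fin 3) (w.1.adicCompletion L)) = β • (1 : Matrix (Fin 3) (Fin 3) (w.1.adicCompletion L)))
    (hβ : Valued.v β = 1)
    (ha : (((localNonsplitEquiv (IsCMField.complexConj L) (qsForm L) (IsCMField.complexConj_ne_one L) w hw a :
        ↥(unitaryGroupOfForm (galAdicCompletionMap (L := L) (IsCMField.complexConj L) hw) (placeForm (qsForm L) w.1))) :
        GL (Fin 3) (w.1.adicCompletion L)) : Matrix (Fin 3) (Fin 3) (w.1.adicCompletion L)) =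
        Matrix.diagonal ![α, 1, ((galAdicCompletionMap (L := L) (IsCMField.complexConj L) hw) α)⁻¹])
    (hα0 : α ≠ 0) (hα1 : Valued.v α < 1) {m : ℕ} (hm : 1 ≤ m)
    (K₂ : Subgroup ((cmDatum L 2 (Matrix.of fun i j : Fin 2 => if i.val + j.val + 1 = 2 then (1 : L) else 0)).Local v)) {r₂ : WithZero (Multiplicative ℤ)} (hr₂ : r₂ < 1)
    (hK₂ : ∀ k ∈ K₂, ∀ i j, Valued.v ((((localNonsplitEquiv (IsCMField.complexConj L) (Matrix.of fun i j : Fin 2 => if i.val + j.val + 1 = 2 then (1 : L) else 0) (IsCMField.complexConj_ne_one L) w hw k :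
        ↥(unitaryGroupOfForm (galAdicCompletionMap (L := L) (IsCMField.complexConj L) hw) (placeForm (Matrix.of fun i j : Fin 2 => if i.val + j.val + 1 = 2 then (1 : L) else 0) w.1))) :
        GL (Fin 2) (w.1.adicCompletion L)) : Matrix (Fin 2) (Fin 2) (w.1.adicCompletion L)) i j - (1 : Matrix (Fin 2) (Fin 2) (w.1.adicCompletion L)) i j) ≤ r₂)
    {z₂ a₂ : (cmDatum L 2 (Matrix.of fun i j : Fin 2 => if i.val + j.val + 1 = 2 then (1 : L) else 0)).Local v} {β₂ α₂ : w.1.adicCompletion L}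
    (hz₂ : (((localNonsplitEquiv (IsCMField.complexConj L) (Matrix.of fun i j : Fin 2 => if i.val + j.val + 1 = 2 then (1 : L) else 0) (IsCMField.complexConj_ne_one L) w hw z₂ :
        ↥(unitaryGroupOfForm (galAdicCompletionMap (L := L) (IsCMField.complexConj L) hw) (placeForm (Matrix.of fun i j : Fin 2 => if i.val + j.val + 1 = 2 then (1 : L) else 0) w.1))) :
        GL (Fin 2) (w.1.adicCompletion L)) : Matrix (Fin 2) (Fin 2) (w.1.adicCompletion L)) = β₂ • (1 : Matrix (Fin 2) (Fin 2) (w.1.adicCompletion L)))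
    (hβ₂ : Valued.v β₂ = 1)
    (ha₂ : (((localNonsplitEquiv (IsCMField.complexConj L) (Matrix.of fun i j : Fin 2 => if i.val + j.val + 1 = 2 then (1 : L) else 0) (IsCMField.complexConj_ne_one L) w hw a₂ :
        ↥(unitaryGroupOfForm (galAdicCompletionMap (L := L) (IsCMField.complexConj L) hw) (placeForm (Matrix.of fun i j : Fin 2 => if i.val + j.val + 1 = 2 then (1 : L) else 0) w.1))) :
        GL (Fin 2) (w.1.adicCompletion L)) : Matrix (Fin 2) (Fin 2) (w.1.adicCompletion L)) =
        Matrix.diagonal ![α₂, ((galAdicCompletionMap (L := L) (IsCMField.complexConj L) hw) α₂)⁻¹])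
    (hα₂0 : α₂ ≠ 0) (hα₂1 : Valued.v α₂ < 1) {m₂ : ℕ} (hm₂ : 1 ≤ m₂)
    [∀ γ : (cmDatum L 3 (qsForm L)).Local v, MeasurableSpace ((cmDatum L 3 (qsForm L)).Local v ⧸ Subgroup.centralizer ({γ} : Set ((cmDatum L 3 (qsForm L)).Local v)))]
    [∀ aH : ((cmDatum L 2 (Matrix.of fun i j : Fin 2 => if i.val + j.val + 1 = 2 then (1 : L) else 0)).Local v × (cmDatum L 1 (Matrix.of fun i j : Fin 1 => if i.val + j.val + 1 = 1 then (1 : L) else 0)).Local v),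
      MeasurableSpace (((cmDatum L 2 (Matrix.of fun i j : Fin 2 => if i.val + j.val + 1 = 2 then (1 : L) else 0)).Local v × (cmDatum L 1 (Matrix.of fun i j : Fin 1 => if i.val + j.val + 1 = 1 then (1 : L) else 0)).Local v) ⧸
        Subgroup.centralizer ({aH} : Set ((cmDatum L 2 (Matrix.of fun i j : Fin 2 => if i.val + j.val + 1 = 2 then (1 : L) else 0)).Local v × (cmDatum L 1 (Matrix.of fun i j : Fin 1 => if i.val + j.val + 1 = 1 then (1 : L) else 0)).Local v)))]
    (T : LocalTransferFactor L (qsForm L) v)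
    (mH : OrbitalMeasureFamily ((cmDatum L 2 (Matrix.of fun i j : Fin 2 => if i.val + j.val + 1 = 2 then (1 : L) else 0)).Local v ×
      (cmDatum L 1 (Matrix.of fun i j : Fin 1 => if i.val + j.val + 1 = 1 then (1 : L) else 0)).Local v))
    (mG : OrbitalMeasureFamily ((cmDatum L 3 (qsForm L)).Local v))
    (fH : ((cmDatum L 2 (Matrix.of fun i j : Fin 2 => if i.val + j.val + 1 = 2 then (1 : L) else 0)).Local v ×
      (cmDatum L 1 (Matrix.of fun i j : Fin 1 => if i.val + j.val + 1 = 1 then (1 : L) else 0)).Local v) → ℂ)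
    (hfH : ∀ x ∈ tsupport fH, x.1 ∈ DoubleCoset.doubleCoset (z₂ * a₂ ^ m₂) (K₂ : Set ((cmDatum L 2 (Matrix.of fun i j : Fin 2 => if i.val + j.val + 1 = 2 then (1 : L) else 0)).Local v)) K₂)
    (f : (cmDatum L 3 (qsForm L)).Local v → ℂ)
    (hf : tsupport f ⊆ DoubleCoset.doubleCoset (z * a ^ m) (Kn : Set ((cmDatum L 3 (qsForm L)).Local v)) Kn)
    (hlevi : ∀ (γH : ((cmDatum L 2 (Matrix.of fun i j : Fin 2 => if i.val + j.val + 1 = 2 then (1 : L) else 0)).Local v × (cmDatum L 1 (Matrix.of fun i j : Fin 1 => if i.val + j.val + 1 = 1 then (1 : L) else 0)).Local v)) (d' : Fin 2 → (LocalRing L v)ˣ),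
      glDiagonal 2 (LocalRing L v) d' = ((γH.1).val : GL (Fin 2) (LocalRing L v)) → IsLocalGRegular L v γH →
      Valued.v (((d' 1 : (LocalRing L v)ˣ) : LocalRing L v) w) < Valued.v (((d' 0 : (LocalRing L v)ˣ) : LocalRing L v) w) →
      galAdicCompletionMap (L := L) (IsCMField.complexConj L) hw (((d' 0 : (LocalRing L v)ˣ) : LocalRing L v) w) * ((d' 1 : (LocalRing L v)ˣ) : LocalRing L v) w = 1 →
      classOrbitalIntegral mH fH (ConjClasses.mk γH) = ∑ᶠ c : ConjClasses ((cmDatum L 3 (qsForm L)).Local v), T.Δ γH (Quotient.out c) * classOrbitalIntegral mG f c) :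
    IsLocalDeltaTransfer L (qsForm L) v T mH mG fH f :=
  F0P3cStCharTSOffStratumCM.isLocalDeltaTransfer_of_on L v w hw Kn hr hK hz hβ ha hα0 hα1 hm K₂ hr₂ hK₂ hz₂ hβ₂ ha₂ hα₂0 hα₂1 hm₂ T mH mG fH hfH f hf
    (fun γH hreg hon => hon_of_levi L v w hw T mH mG fH f hlevi γH hreg hon)

end Summit.HodgeConjecture.HodgeConjecture.Cruxes.H413.F0P3cStCharTSTransferOfLevi
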